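import Summits.QuantumFields.YangMills.Theorems.CentreWallReflectionSlabPSD2
import HarnessLib

/-!
# Slab decomposition of the four-torus Wilson weight, IX: the wall reflection bound on ODD tori (preliminaries)
# (crux `CentreWallReflection.WallReflection` ⟨stmt-QuantumFields-23707⟩, line `birth`, stub `stub_instantiate`; planner ym-idea-4 g18)

Stokes core (pinned ladder plaquette from a far transported holonomy), the ABSOLUTE bad-bond bound `∫∫𝟙[far]Ψ_1 ≤ (n+1)e^{−βδ/(n+1)²}`,
the wall ring weight at slice `j`, and `core_odd`: on a torus of odd side `n+1 = 2m+1`, the registered odd ring lemma `stub_oddRing` with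
`Ψ = Ψ_m`, `K = Ψ_1` (positive semi-definite), the close pairs `∃u, N − Re tr ρ(P(a)⁻¹uP(a')u⁻¹) < δ`, gives `Z(z) ≤ 8εZ(1) ≤ 16εZ(1)`.
HONEST FRAMING: lattice bookkeeping toward ONE crux of a draft route (fixed torus, finite lattice); nothing here proves the route's target
`MarginalTwistOnset.FixedTorusCriterionFailure`, any continuum statement, or the Yang–Mills mass gap.  THEOREMS ONLY (no `def`, no `sorry`),
standard axioms.  References: [cite: OsterwalderSeiler1978, §2]; [cite: tHooft1979]; E. T. Tomboulis, L. G. Yaffe, CMP 100 (1985) 313;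
[cite: Luscher1983, §2].
-/

set_option autoImplicit false

noncomputable section

open scoped BigOperators
open MeasureTheory Literature.MathematicalPhysics.QuantumFieldTheory

namespace Summit.QuantumFields.YangMills.Theorems.CentreWallReflection.Slab

open MeasureTheory
open Summit.QuantumFields.YangMills.Theorems.FemtoCurvatureTwoPointC (LatticeStokes.sub_re_trace_map_rectangleHolonomy_le)
open Summit.QuantumFields.YangMills.Theorems.FemtoTransferGap.FluxReflection (abs_ind_le_one ind_nonneg ind_le_one weight_mono)

/-! ## §20 The odd ring on the lattice -/

section OddPrelim

variable {n : ℕ} {G : Type*} [Group G] [TopologicalSpace G] [IsTopologicalGroup G] [CompactSpace G]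
  [MeasurableSpace G] [BorelSpace G] [SecondCountableTopology G] {N : ℕ} (ρ : G →* Matrix (Fin N) (Fin N) ℂ) (μ ν : Fin 4)


omit [TopologicalSpace G] [IsTopologicalGroup G] [CompactSpace G] [MeasurableSpace G] [BorelSpace G] [SecondCountableTopology G] in
/-- **Stokes core**: if the transported Polyakov holonomies of two consecutive slices are `δ`-far in trace, some ladder plaquette is pinned. -/
theorem exists_pinned_of_far (hU : ∀ g, ρ g ∈ Matrix.unitaryGroup (Fin N) ℂ) {δ : ℝ} (t : ℕ) (W : (GaugeConfig 4 (n + 1) G))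
    (hδ : δ ≤ (N : ℝ) - (ρ ((polyakov μ ν t W)⁻¹ *
      (W (baseSite μ t, μ) * polyakov μ ν (t + 1) W * (W (baseSite μ t, μ))⁻¹))).trace.re) :
    ∃ s ∈ Finset.range (n + 1), δ / (((n + 1 : ℕ) : ℝ) ^ 2) ≤
      (N : ℝ) - (ρ (plaquetteHolonomy W (baseSite μ t + Pi.single ν (s : ZMod (n + 1))) μ ν)).trace.re := by
  have hS0 := LatticeStokes.sub_re_trace_map_rectangleHolonomy_le ρ hU W μ ν 1 (n + 1) (baseSite μ t)
  have hS : (N : ℝ) - (ρ (W (baseSite μ t, μ) * polyakov μ ν (t + 1) W * (W (baseSite μ t, μ))⁻¹ * (polyakov μ ν t W)⁻¹)).trace.re ≤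
      ((n + 1 : ℕ) : ℝ) * ∑ s ∈ Finset.range (n + 1),
        ((N : ℝ) - (ρ (plaquetteHolonomy W (baseSite μ t + Pi.single ν (s : ZMod (n + 1))) μ ν)).trace.re) := by
    rw [rectangleHolonomy_ladder (μ := μ) (ν := ν) t W] at hS0
    simpa only [Finset.sum_range_one, Nat.cast_zero, Pi.single_zero, add_zero, one_mul] using hS0
  have htr : (ρ ((polyakov μ ν t W)⁻¹ * (W (baseSite μ t, μ) * polyakov μ ν (t + 1) W * (W (baseSite μ t, μ))⁻¹))).trace.re =
      (ρ (W (baseSite μ t, μ) * polyakov μ ν (t + 1) W * (W (baseSite μ t, μ))⁻¹ * (polyakov μ ν t W)⁻¹)).trace.re := by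
    rw [map_mul ρ (polyakov μ ν t W)⁻¹, Matrix.trace_mul_comm, ← map_mul]
  rw [htr] at hδ
  have hpos : (0 : ℝ) < ((n + 1 : ℕ) : ℝ) := by positivity
  have hsum : ∑ _s ∈ Finset.range (n + 1), δ / (((n + 1 : ℕ) : ℝ) ^ 2) ≤
      ∑ s ∈ Finset.range (n + 1), ((N : ℝ) - (ρ (plaquetteHolonomy W (baseSite μ t + Pi.single ν (s : ZMod (n + 1))) μ ν)).trace.re) := by
    rw [Finset.sum_const, Finset.card_range, nsmul_eq_mul]
    have e : ((n + 1 : ℕ) : ℝ) * (δ / (((n + 1 : ℕ) : ℝ) ^ 2)) = δ / ((n + 1 : ℕ) : ℝ) := by field_simp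
    rw [e, div_le_iff₀ hpos, mul_comm]
    exact hδ.trans hS
  exact Finset.exists_le_of_sum_le (Finset.nonempty_range_iff.mpr (Nat.succ_ne_zero n)) hsum

omit [TopologicalSpace G] [IsTopologicalGroup G] [CompactSpace G] [MeasurableSpace G] [BorelSpace G] [SecondCountableTopology G] in
/-- A layer-`0` ladder plaquette is dominated by the one-layer slab action. -/
theorem plaqCost_le_slabAction_one (hU : ∀ g, ρ g ∈ Matrix.unitaryGroup (Fin N) ℂ) (hμν : μ < ν) (W : (GaugeConfig 4 (n + 1) G)) (s : ℕ) :
    plaqCost ρ W (baseSite μ 0 + Pi.single ν (s : ZMod (n + 1)), ⟨(μ, ν), hμν⟩) ≤ slabAction ρ μ 1 W := by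
  unfold slabAction
  set p : Plaquette 4 (n + 1) := (baseSite μ 0 + Pi.single ν (s : ZMod (n + 1)), ⟨(μ, ν), hμν⟩)
  have hw : slabWeight μ 1 p = 1 := by
    have hT : isTemporal μ p = true := (isTemporal_iff μ p).mpr (Or.inl rfl)
    have hlev : (p.1 μ).val = 0 := by
      show ((baseSite μ 0 + Pi.single ν (s : ZMod (n + 1)) : Site 4 (n + 1)) μ).val = 0
      rw [Pi.add_apply, baseSite_apply_self, Pi.single_eq_of_ne (ne_of_lt hμν), add_zero, Nat.cast_zero, ZMod.val_zero]
    unfold slabWeight; rw [if_pos hT, hlev, if_pos Nat.one_pos]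
  calc plaqCost ρ W p = slabWeight μ 1 p * plaqCost ρ W p := by rw [hw, one_mul]
    _ ≤ ∑ q : Plaquette 4 (n + 1), slabWeight μ 1 q * plaqCost ρ W q :=
      Finset.single_le_sum (fun q _ => mul_nonneg (slabWeight_nonneg μ 1 q) (plaqCost_nonneg ρ hU W q)) (Finset.mem_univ p)

/-- **The bad-bond weight of the one-layer kernel is absolutely small**:
`∫∫ 𝟙[far](A,A') Ψ_1(A,A') ≤ (n+1) e^{−β δ/(n+1)²}`. -/
theorem integral_far_slabKernel_one_le (hn : 1 ≤ n) (hρ : Continuous ρ) (hU : ∀ g, ρ g ∈ Matrix.unitaryGroup (Fin N) ℂ)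
    (hμν : μ < ν) {β : ℝ} (hβ : 0 ≤ β) (δ : ℝ) :
    ∫ A, ∫ A', {p : (GaugeConfig 4 (n + 1) G) × (GaugeConfig 4 (n + 1) G) | ∀ u : G, δ ≤ (N : ℝ) - (ρ ((polyakov μ ν 0 p.1)⁻¹ * (u * polyakov μ ν 0 p.2 * u⁻¹))).trace.re}.indicator
        (fun _ => (1 : ℝ)) (A, A') * slabKernel ρ μ β 1 A A' ∂(MeasureTheory.Measure.pi (fun _ : Edge 4 (n + 1) => haarProbability G)) ∂(MeasureTheory.Measure.pi (fun _ : Edge 4 (n + 1) => haarProbability G)) ≤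
      ((n + 1 : ℕ) : ℝ) * Real.exp (-(β * (δ / (((n + 1 : ℕ) : ℝ) ^ 2)))) := by
  set Far : Set ((GaugeConfig 4 (n + 1) G) × (GaugeConfig 4 (n + 1) G)) := {p : (GaugeConfig 4 (n + 1) G) × (GaugeConfig 4 (n + 1) G) | ∀ u : G, δ ≤ (N : ℝ) - (ρ ((polyakov μ ν 0 p.1)⁻¹ * (u * polyakov μ ν 0 p.2 * u⁻¹))).trace.re}
  set s₀ : ℝ := δ / (((n + 1 : ℕ) : ℝ) ^ 2)
  have hμν' : μ ≠ ν := ne_of_lt hμν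
  -- the pinned-plaquette indicators of the glued one-layer configuration
  set c : (GaugeConfig 4 (n + 1) G) → (GaugeConfig 4 (n + 1) G) → ℕ → (GaugeConfig 4 (n + 1) G) → ℝ := fun A A' s U => Real.exp (-(β * s₀)) * {W : (GaugeConfig 4 (n + 1) G) | s₀ ≤ plaqCost ρ W
    (baseSite μ 0 + Pi.single ν (s : ZMod (n + 1)), ⟨(μ, ν), hμν⟩)}.indicator (fun _ => (1 : ℝ)) (glue μ 1 U A A') with hc
  have hc0 : ∀ A A' s U, 0 ≤ c A A' s U := fun A A' s U => mul_nonneg (Real.exp_pos _).le (Set.indicator_nonneg (fun _ _ => zero_le_one) _)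
  have hc1 : ∀ A A' s U, |c A A' s U| ≤ Real.exp (-(β * s₀)) := fun A A' s U => by
    rw [hc]; dsimp only; rw [abs_mul, abs_of_pos (Real.exp_pos _)]
    exact mul_le_of_le_one_right (Real.exp_pos _).le (abs_ind_le_one _ _)
  have hcm : ∀ A A' s, Measurable (c A A' s) := fun A A' s =>
    measurable_const.mul ((measurable_const.indicator (measurableSet_le measurable_const
      (continuous_plaqCost ρ hρ _).measurable)).comp (measurable_glue_left μ 1 A A'))
  -- pointwise in `(A, A', U)`
  have hpt : ∀ A A' U : (GaugeConfig 4 (n + 1) G), Far.indicator (fun _ => (1 : ℝ)) (A, A') * Real.exp (-(β * slabAction ρ μ 1 (glue μ 1 U A A'))) ≤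
      ∑ s ∈ Finset.range (n + 1), c A A' s U := by
    intro A A' U
    by_cases hfar : (A, A') ∈ Far
    · rw [Set.indicator_of_mem hfar, one_mul]
      have hP0 : polyakov μ ν 0 (glue μ 1 U A A') = polyakov μ ν 0 A := polyakov_zero_glue hμν' 1 U A A'
      have hP1 : polyakov μ ν 1 (glue μ 1 U A A') = polyakov μ ν 0 A' := polyakov_glue_sliceJ hμν' le_rfl hn U A A'
      have hδ : δ ≤ (N : ℝ) - (ρ ((polyakov μ ν 0 (glue μ 1 U A A'))⁻¹ *
          ((glue μ 1 U A A') (baseSite μ 0, μ) * polyakov μ ν (0 + 1) (glue μ 1 U A A') *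
            ((glue μ 1 U A A') (baseSite μ 0, μ))⁻¹))).trace.re := by
        rw [Nat.zero_add, hP0, hP1]; exact hfar _
      obtain ⟨s, hs, hle⟩ := exists_pinned_of_far ρ μ ν hU 0 (glue μ 1 U A A') hδ
      refine le_trans ?_ (Finset.single_le_sum (fun s _ => hc0 A A' s U) hs)
      rw [hc]; dsimp only
      rw [Set.indicator_of_mem (show glue μ 1 U A A' ∈ {W : (GaugeConfig 4 (n + 1) G) | s₀ ≤ plaqCost ρ W
        (baseSite μ 0 + Pi.single ν (s : ZMod (n + 1)), ⟨(μ, ν), hμν⟩)} from hle), mul_one]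
      exact Real.exp_le_exp.mpr (neg_le_neg (mul_le_mul_of_nonneg_left
        (hle.trans (plaqCost_le_slabAction_one ρ μ ν hU hμν _ s)) hβ))
    · rw [Set.indicator_of_notMem hfar, zero_mul]
      exact Finset.sum_nonneg fun s _ => hc0 A A' s U
  -- integrate in `U`, then in `A'`, then in `A`
  have hind : ∀ (A A' : (GaugeConfig 4 (n + 1) G)) (s : ℕ), ∫ U, c A A' s U ∂(MeasureTheory.Measure.pi (fun _ : Edge 4 (n + 1) => haarProbability G)) ≤ Real.exp (-(β * s₀)) := by
    intro A A' s
    calc _ ≤ ∫ _U : (GaugeConfig 4 (n + 1) G), Real.exp (-(β * s₀)) ∂(MeasureTheory.Measure.pi (fun _ : Edge 4 (n + 1) => haarProbability G)) :=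
          integral_mono_of_nonneg (ae_of_all _ fun U => hc0 A A' s U) (integrable_const _)
            (ae_of_all _ fun U => (le_abs_self _).trans (hc1 A A' s U))
      _ = Real.exp (-(β * s₀)) := by simp
  have hinner : ∀ A A' : (GaugeConfig 4 (n + 1) G), Far.indicator (fun _ => (1 : ℝ)) (A, A') * slabKernel ρ μ β 1 A A' ≤
      ((n + 1 : ℕ) : ℝ) * Real.exp (-(β * s₀)) := by
    intro A A'
    unfold slabKernel
    rw [← integral_const_mul]
    have hci : ∀ s, Integrable (c A A' s) (MeasureTheory.Measure.pi (fun _ : Edge 4 (n + 1) => haarProbability G)) := fun s => integrable_of_bdd (hcm A A' s) (hc1 A A' s) _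
    calc ∫ U, Far.indicator (fun _ => (1 : ℝ)) (A, A') * Real.exp (-(β * slabAction ρ μ 1 (glue μ 1 U A A'))) ∂(MeasureTheory.Measure.pi (fun _ : Edge 4 (n + 1) => haarProbability G))
        ≤ ∫ U, ∑ s ∈ Finset.range (n + 1), c A A' s U ∂(MeasureTheory.Measure.pi (fun _ : Edge 4 (n + 1) => haarProbability G)) :=
          integral_mono_of_nonneg (ae_of_all _ fun U => mul_nonneg (Set.indicator_nonneg (fun _ _ => zero_le_one) _)
            (Real.exp_pos _).le) (integrable_finsetSum _ fun s _ => hci s) (ae_of_all _ fun U => hpt A A' U)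
      _ = ∑ s ∈ Finset.range (n + 1), ∫ U, c A A' s U ∂(MeasureTheory.Measure.pi (fun _ : Edge 4 (n + 1) => haarProbability G)) := integral_finsetSum _ fun s _ => hci s
      _ ≤ ∑ _s ∈ Finset.range (n + 1), Real.exp (-(β * s₀)) := Finset.sum_le_sum fun s _ => hind A A' s
      _ = ((n + 1 : ℕ) : ℝ) * Real.exp (-(β * s₀)) := by rw [Finset.sum_const, Finset.card_range, nsmul_eq_mul]
  calc ∫ A, ∫ A', Far.indicator (fun _ => (1 : ℝ)) (A, A') * slabKernel ρ μ β 1 A A' ∂(MeasureTheory.Measure.pi (fun _ : Edge 4 (n + 1) => haarProbability G)) ∂(MeasureTheory.Measure.pi (fun _ : Edge 4 (n + 1) => haarProbability G))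
      ≤ ∫ _A : (GaugeConfig 4 (n + 1) G), ∫ _A' : (GaugeConfig 4 (n + 1) G), ((n + 1 : ℕ) : ℝ) * Real.exp (-(β * s₀)) ∂(MeasureTheory.Measure.pi (fun _ : Edge 4 (n + 1) => haarProbability G)) ∂(MeasureTheory.Measure.pi (fun _ : Edge 4 (n + 1) => haarProbability G)) := by
        refine integral_mono_of_nonneg (ae_of_all _ fun A => integral_nonneg fun A' => mul_nonneg
          (Set.indicator_nonneg (fun _ _ => zero_le_one) _) (slabKernel_nonneg ρ μ β 1 A A')) (integrable_const _)
          (ae_of_all _ fun A => ?_)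
        exact integral_mono_of_nonneg (ae_of_all _ fun A' => mul_nonneg (Set.indicator_nonneg (fun _ _ => zero_le_one) _)
          (slabKernel_nonneg ρ μ β 1 A A')) (integrable_const _) (ae_of_all _ fun A' => hinner A A')
    _ = ((n + 1 : ℕ) : ℝ) * Real.exp (-(β * s₀)) := by simp

/-- The wall ring weight with insertion at slice `j` is the wall weight of slice `j`. -/
theorem wallRingJ_eq (hρ : Continuous ρ) (hU : ∀ g, ρ g ∈ Matrix.unitaryGroup (Fin N) ℂ) (hμν : μ ≠ ν) {β : ℝ} (hβ : 0 ≤ β)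
    {j : ℕ} (hj1 : 1 ≤ j) (hjn : j ≤ n) {Wset : Set G} (hWm : MeasurableSet Wset) :
    ∫ X, ∫ A, slabKernel ρ μ β j X A * {B : (GaugeConfig 4 (n + 1) G) | polyakov μ ν 0 B ∈ Wset}.indicator (fun _ => (1 : ℝ)) A *
        slabKernel ρ μ β (n + 1 - j) A X ∂(MeasureTheory.Measure.pi (fun _ : Edge 4 (n + 1) => haarProbability G)) ∂(MeasureTheory.Measure.pi (fun _ : Edge 4 (n + 1) => haarProbability G)) = wallWeight (n := n) ρ μ ν β Wset j := by
  have hHm : Measurable fun W : (GaugeConfig 4 (n + 1) G) => Wset.indicator (fun _ => (1 : ℝ)) (polyakov μ ν j W) :=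
    (measurable_const.indicator hWm).comp (measurable_polyakov μ ν j)
  have h := ring_identity ρ μ hρ hU hβ hj1 hjn hHm (CH := 1) (fun W => abs_ind_le_one _ _)
    (Hb := fun _ A => {B : (GaugeConfig 4 (n + 1) G) | polyakov μ ν 0 B ∈ Wset}.indicator (fun _ => (1 : ℝ)) A) ?_
  · unfold wallWeight boltz
    rw [h]
    refine integral_congr_ae (ae_of_all _ fun X => integral_congr_ae (ae_of_all _ fun A => ?_))
    dsimp only; ring
  · intro U X A
    rw [polyakov_glue_sliceJ hμν hj1 hjn]
    by_cases h : polyakov μ ν 0 A ∈ Wset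
    · rw [Set.indicator_of_mem h, Set.indicator_of_mem (show A ∈ {B : (GaugeConfig 4 (n + 1) G) | polyakov μ ν 0 B ∈ Wset} from h)]
    · rw [Set.indicator_of_notMem h, Set.indicator_of_notMem (show A ∉ {B : (GaugeConfig 4 (n + 1) G) | polyakov μ ν 0 B ∈ Wset} from h)]

end OddPrelim

end Summit.QuantumFields.YangMills.Theorems.CentreWallReflection.Slab

end
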